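import Literature.MathematicalPhysics.QuantumLattice.WilsonDiracAP
import Literature.MathematicalPhysics.QuantumLattice.GrassmannIntegralProofs
import Summits.QuantumFields.QCD.Theorems.QuarksAsStableActionWilsonQuarkStabilityTangentDelta

/-!
# The perturbation `Δ = D[ω V] − D[ω]` of the free twisted Wilson–Dirac operator, `N` colours:
entries and Frobenius sums
(helper for crux stmt-QuantumFields-9307 `FlatCellOptimal`, line `registered`, stubs
`stub_hessianMarginAllN` / `stub_localNormGain_of`, sub-goal `stub_tangentDeltaAllN` — the
`Fin 3 ↦ Fin N` port of the sibling crux stmt-QuantumFields-9736's `…WilsonQuarkStabilityTangentDelta`,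
gap G2a, wave 3)

What.  For ANY colour number `N : ℕ`, a constant central phase `ω ∈ U(N)` (`(ω : Matrix) = e^{iθ}·1`),
a `U(N)` link field `V` on `(ℤ/L)⁴` and `D[X] = wilsonDirac ρ_N X m 1` (`r = 1`, bare mass `m`):

* `wilsonDirac_phase_sub_apply`: the entries of `Δ := D[fun e => ω * V e] − D[fun _ => ω]` (the
  mass/Wilson diagonal cancels; only the eight hopping blocks survive, with colour factors
  `ρ(ωV) − ρ(ω)` and `ρ(ωV)⁻¹ − ρ(ω)⁻¹`);
* `rep_phase_mul_sub`, `rep_phase_mul_inv_sub`: those colour factors are `e^{iθ}(V − 1)` and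
  `e^{-iθ}(Vᴴ − 1)`, with entry norms `‖(V − 1)_{ab}‖`, `‖(V − 1)_{ba}‖`
  (`norm_exp_mul_I_smul_apply`, `norm_exp_neg_mul_I_smul_star_sub_one_apply`);
* `sum_norm_sq_sub_one`: `Σ_{ab} ‖(V − 1)_{ab}‖² = 2 (N − Re tr V)` for unitary `V` — the link between
  the Frobenius norm of `E = V − 1` and the link deficit, used by every Frobenius/operator bound of
  the hopping perturbation downstream (siblings `…StubDeltaBounds`, `…StubUnitaryCellIneq`);
* `sum_norm_ite_site_eq`, `sum_norm_ite_shift_eq`: column sums of site-localised blocks;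
* `sq_sum_block_le`, `sum_sq_rowsum_delta_le`: the `ℓ¹` row-sum bound
  `Σ_p (Σ_q ‖Δ_pq‖)² ≤ 256 N · Σ_e (N − Re tr V_e)` (Cauchy–Schwarz over the eight hopping blocks
  and over colour × spin).  This is the ONLY place where the colour number enters, and it enters
  HONESTLY: Cauchy–Schwarz over the `N` colour entries of a row costs a factor `N`
  (`(Σ_b ‖C_{ab}‖)² ≤ N Σ_b ‖C_{ab}‖²`, sharp for the Householder reflection `V = 1 − 2ψψᴴ`,
  `ψ = N^{-1/2}(1,…,1)`, whose `V − 1` has all entries `−2/N`); at `N = 3` it is the sibling's `768`.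
  The `ℓ¹` row sum is used only by the Gershgorin-type argument of crux 9736; the chessboard chain
  of this crux uses the `N`-FREE Frobenius and operator bounds instead.

The colour-free lemmas of the sibling file (`Σ_{ab} ‖M_{ab}‖² = Re tr(Mᴴ M)` for any finite index,
`tr γ_μ = 0`, `‖1 ± γ_μ‖_F² = 8`, `x = y + μ̂ ↔ y = x − μ̂`) are imported and re-EXPORTED into this
namespace (aliases, no restatement).  The registered sub-goal `stub_tangentDeltaAllN` is the
conjunction, at colour `Fin N`, of the exports consumed by the siblings `…StubDeltaBounds` and
`…StubUnitaryCellIneq`.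

References: Montvay–Münster, *Quantum Fields on a Lattice* §4.2 (Wilson–Dirac operator); folklore
linear algebra.  Pure theorem file (no definitions).
-/

namespace Summit.QuantumFields.QCD.Cruxes.FlatCellOptimal.TangentDelta

open Literature.MathematicalPhysics Literature.MathematicalPhysics.QuantumLattice
  Literature.MathematicalPhysics.QuantumFieldTheory Literature.Probability.LatticeModels
open Matrix Complex
open scoped Kronecker ComplexOrder ComplexConjugate BigOperators

noncomputable section

/-! ### Colour-free lemmas of the sibling file, re-exported -/

export Summit.QuantumFields.QCD.Cruxes.WilsonQuarkStability.FreeTangentLandauChessboard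
  (sum_norm_sq_eq_re_trace_conjTranspose_mul_self trace_euclideanGamma
    sum_norm_sq_one_add_smul_gamma eq_shift_iff')

variable {N L : ℕ}

/-! ### Entries of `Δ` -/

/-- **Entries of the perturbation** `Δ = D[ω V] − D[ω]` (`N` colours): the diagonal (mass + Wilson)
part cancels and the hopping blocks subtract. -/
theorem wilsonDirac_phase_sub_apply (ω : Matrix.unitaryGroup (Fin N) ℂ)
    (V : GaugeConfig 4 L (Matrix.unitaryGroup (Fin N) ℂ)) (m : ℝ)
    (p q : TorusSite 4 L × Fin N × Fin 4) :
    (wilsonDirac (unitaryFundamentalRep (Fin N) ℂ) (fun e => ω * V e) m 1 -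
        wilsonDirac (unitaryFundamentalRep (Fin N) ℂ)
          (fun _ : Edge 4 L => ω) m 1) p q =
      -(1 / 2 : ℂ) * ∑ μ : Fin 4,
        ((if q.1 = Site.shift p.1 μ then
            ((1 : ℂ) • (1 : Matrix (Fin 4) (Fin 4) ℂ) - euclideanGamma μ) p.2.2 q.2.2 *
              ((unitaryFundamentalRep (Fin N) ℂ (ω * V (p.1, μ))) -
                unitaryFundamentalRep (Fin N) ℂ ω) p.2.1 q.2.1 else 0) +
          (if p.1 = Site.shift q.1 μ then
            ((1 : ℂ) • (1 : Matrix (Fin 4) (Fin 4) ℂ) + euclideanGamma μ) p.2.2 q.2.2 *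
              (unitaryFundamentalRep (Fin N) ℂ (ω * V (q.1, μ))⁻¹ -
                unitaryFundamentalRep (Fin N) ℂ ω⁻¹) p.2.1 q.2.1 else 0)) := by
  -- adapted from the sibling `…WilsonQuarkStabilityTangentDelta` (`Fin 3 ↦ Fin N`, textual)
  rw [Matrix.sub_apply]
  simp only [wilsonDirac, Matrix.of_apply, Complex.ofReal_one, one_smul]
  rw [sub_sub_sub_cancel_left, ← mul_sub, ← Finset.sum_sub_distrib, neg_mul, ← mul_neg,
    ← Finset.sum_neg_distrib]
  refine congrArg₂ (· * ·) rfl (Finset.sum_congr rfl fun μ _ => ?_)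
  split_ifs <;> (try simp only [Matrix.sub_apply, mul_sub]) <;> ring

/-! ### The colour factors -/

/-- `ρ(ω g) − ρ(ω) = e^{iθ} (g − 1)` for the central phase `ω = e^{iθ}·1 ∈ U(N)`. -/
theorem rep_phase_mul_sub {θ : ℝ} {ω : Matrix.unitaryGroup (Fin N) ℂ}
    (hω : (ω : Matrix (Fin N) (Fin N) ℂ) = Complex.exp (θ * I) • (1 : Matrix (Fin N) (Fin N) ℂ))
    (g : Matrix.unitaryGroup (Fin N) ℂ) :
    unitaryFundamentalRep (Fin N) ℂ (ω * g) - unitaryFundamentalRep (Fin N) ℂ ω =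
      Complex.exp (θ * I) • ((g : Matrix (Fin N) (Fin N) ℂ) - 1) := by
  simp only [unitaryFundamentalRep_apply, Matrix.UnitaryGroup.mul_val]
  rw [hω, Matrix.smul_mul, Matrix.one_mul, smul_sub]

/-- `ρ((ω g)⁻¹) − ρ(ω⁻¹) = e^{-iθ} (gᴴ − 1)` for the central phase `ω = e^{iθ}·1 ∈ U(N)`. -/
theorem rep_phase_mul_inv_sub {θ : ℝ} {ω : Matrix.unitaryGroup (Fin N) ℂ}
    (hω : (ω : Matrix (Fin N) (Fin N) ℂ) = Complex.exp (θ * I) • (1 : Matrix (Fin N) (Fin N) ℂ))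
    (g : Matrix.unitaryGroup (Fin N) ℂ) :
    unitaryFundamentalRep (Fin N) ℂ (ω * g)⁻¹ - unitaryFundamentalRep (Fin N) ℂ ω⁻¹ =
      Complex.exp (-(θ * I)) • (star (g : Matrix (Fin N) (Fin N) ℂ) - 1) := by
  simp only [unitaryFundamentalRep_apply, Matrix.UnitaryGroup.inv_val, Matrix.UnitaryGroup.mul_val]
  have hconj : star (Complex.exp (θ * I)) = Complex.exp (-(θ * I)) := by
    rw [Complex.star_def, ← Complex.exp_conj, map_mul, Complex.conj_ofReal, Complex.conj_I, mul_neg]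
  rw [star_mul, hω, star_smul, star_one, hconj, Matrix.mul_smul, Matrix.mul_one, smul_sub]

/-- Entry norms of `e^{iθ} M`: the phase drops out (any `N`). -/
theorem norm_exp_mul_I_smul_apply (θ : ℝ) (M : Matrix (Fin N) (Fin N) ℂ) (a b : Fin N) :
    ‖(Complex.exp (θ * I) • M) a b‖ = ‖M a b‖ := by
  rw [Matrix.smul_apply, smul_eq_mul, norm_mul, Complex.norm_exp_ofReal_mul_I, one_mul]

/-- Entry norms of `e^{-iθ}(gᴴ − 1)`: the phase drops out and `‖(gᴴ − 1)_{ab}‖ = ‖(g − 1)_{ba}‖`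
(any `N`). -/
theorem norm_exp_neg_mul_I_smul_star_sub_one_apply (θ : ℝ) (g : Matrix (Fin N) (Fin N) ℂ)
    (a b : Fin N) :
    ‖(Complex.exp (-(θ * I)) • (star g - 1)) a b‖ = ‖(g - 1) b a‖ := by
  rw [Matrix.smul_apply, smul_eq_mul, norm_mul, show -(↑θ * I) = ↑(-θ) * I by push_cast; ring,
    Complex.norm_exp_ofReal_mul_I, one_mul]
  have : (star g - 1) a b = star ((g - 1) b a) := by
    rw [Matrix.sub_apply, Matrix.sub_apply, Matrix.star_apply, star_sub, Matrix.one_apply,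
      Matrix.one_apply]
    by_cases hab : a = b
    · subst hab; simp
    · rw [if_neg hab, if_neg (Ne.symm hab), star_zero]
  rw [this, norm_star]

/-! ### Frobenius sums -/

/-- For a unitary `g ∈ U(N)`, `Σ_{a,b} ‖(g − 1)_{ab}‖² = 2 (N − Re tr g)`. -/
theorem sum_norm_sq_sub_one (g : Matrix.unitaryGroup (Fin N) ℂ) :
    ∑ a, ∑ b, ‖((g : Matrix (Fin N) (Fin N) ℂ) - 1) a b‖ ^ 2 =
      2 * ((N : ℝ) - ((g : Matrix (Fin N) (Fin N) ℂ)).trace.re) := by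
  -- adapted from the sibling `sum_norm_sq_sub_one` (`Fintype.card_fin` now produces `N`)
  rw [sum_norm_sq_eq_re_trace_conjTranspose_mul_self]
  have hg : (g : Matrix (Fin N) (Fin N) ℂ)ᴴ * (g : Matrix (Fin N) (Fin N) ℂ) = 1 :=
    Matrix.UnitaryGroup.star_mul_self g
  have : (((g : Matrix (Fin N) (Fin N) ℂ) - 1)ᴴ * ((g : Matrix (Fin N) (Fin N) ℂ) - 1)) =
      (1 + 1) - (g : Matrix (Fin N) (Fin N) ℂ) - (g : Matrix (Fin N) (Fin N) ℂ)ᴴ := by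
    rw [conjTranspose_sub, conjTranspose_one, Matrix.sub_mul, Matrix.mul_sub, Matrix.mul_sub,
      Matrix.one_mul, Matrix.one_mul, Matrix.mul_one, hg]
    abel
  rw [this, trace_sub, trace_sub, trace_add, trace_conjTranspose, trace_one, Complex.sub_re,
    Complex.sub_re, Complex.add_re, Complex.star_def, Complex.conj_re, Fintype.card_fin,
    Complex.natCast_re]
  ring

/-! ### Row sums of `Δ` -/

variable [NeZero L]

/-- Summing the norms of a site-localised block over the column index collapses the site sum
(any finite internal index `κ`, here colour × spin `Fin N × Fin 4`). -/
theorem sum_norm_ite_site_eq {κ : Type*} [Fintype κ] (y : TorusSite 4 L) (g : κ → ℂ) :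
    ∑ q : TorusSite 4 L × κ, ‖(if q.1 = y then g q.2 else 0)‖ = ∑ s, ‖g s‖ := by
  rw [Fintype.sum_prod_type]
  simp_rw [apply_ite (‖·‖ : ℂ → ℝ), norm_zero]
  rw [Finset.sum_comm]
  simp

/-- Backward blocks: summing over the column index picks the site `x − e_μ` (any finite internal
index `κ`). -/
theorem sum_norm_ite_shift_eq {κ : Type*} [Fintype κ] (x : TorusSite 4 L) (μ : Fin 4)
    (f : TorusSite 4 L → κ → ℂ) :
    ∑ q : TorusSite 4 L × κ, ‖(if x = QuantumFieldTheory.Site.shift q.1 μ then f q.1 q.2 else 0)‖ =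
      ∑ s, ‖f (x - Pi.single μ 1) s‖ := by
  have : ∀ q : TorusSite 4 L × κ,
      ‖(if x = QuantumFieldTheory.Site.shift q.1 μ then f q.1 q.2 else 0)‖ =
        if q.1 = x - Pi.single μ 1 then ‖f (x - Pi.single μ 1) q.2‖ else 0 := by
    intro q
    by_cases h : q.1 = x - Pi.single μ 1
    · rw [if_pos ((eq_shift_iff' x q.1 μ).mpr h), if_pos h, h]
    · rw [if_neg (fun h' => h ((eq_shift_iff' x q.1 μ).mp h')), if_neg h, norm_zero]
  simp_rw [this]
  rw [Fintype.sum_prod_type, Finset.sum_comm]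
  simp

omit [NeZero L] in
/-- Cauchy–Schwarz for the colour–spin factorised block (`N` colours):
`(Σ_{(b,β)} ‖G_{αβ}‖ ‖C_{ab}‖)² ≤ 4N (Σ_β ‖G_{αβ}‖²)(Σ_b ‖C_{ab}‖²)` — the factor `N` (`4N = 12` at
`N = 3`) is Cauchy–Schwarz over the `N` colour entries and is sharp. -/
theorem sq_sum_block_le (G : Matrix (Fin 4) (Fin 4) ℂ) (C : Matrix (Fin N) (Fin N) ℂ) (α : Fin 4)
    (a : Fin N) :
    (∑ s : Fin N × Fin 4, ‖G α s.2‖ * ‖C a s.1‖) ^ 2 ≤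
      4 * N * (∑ β, ‖G α β‖ ^ 2) * (∑ b, ‖C a b‖ ^ 2) := by
  have hfac : ∑ s : Fin N × Fin 4, ‖G α s.2‖ * ‖C a s.1‖ = (∑ b, ‖C a b‖) * ∑ β, ‖G α β‖ := by
    rw [Fintype.sum_prod_type, Finset.sum_mul_sum]
    refine Finset.sum_congr rfl fun b _ => Finset.sum_congr rfl fun β _ => ?_
    ring
  rw [hfac, mul_pow]
  have h1 : (∑ b, ‖C a b‖) ^ 2 ≤ N * ∑ b, ‖C a b‖ ^ 2 := by
    simpa using sq_sum_le_card_mul_sum_sq (s := Finset.univ) (f := fun b => ‖C a b‖)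
  have h2 : (∑ β, ‖G α β‖) ^ 2 ≤ 4 * ∑ β, ‖G α β‖ ^ 2 := by
    simpa using sq_sum_le_card_mul_sum_sq (s := Finset.univ) (f := fun β => ‖G α β‖)
  calc (∑ b, ‖C a b‖) ^ 2 * (∑ β, ‖G α β‖) ^ 2
      ≤ (N * ∑ b, ‖C a b‖ ^ 2) * (4 * ∑ β, ‖G α β‖ ^ 2) :=
        mul_le_mul h1 h2 (by positivity) (by positivity)
    _ = 4 * N * (∑ β, ‖G α β‖ ^ 2) * (∑ b, ‖C a b‖ ^ 2) := by ring

/-- **The `ℓ¹` row-sum bound** (`N` colours): `Σ_p (Σ_q ‖Δ_pq‖)² ≤ 256 N · Σ_e (N − Re tr V_e)` for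
the perturbation `Δ = D[ω V] − D[ω]` by a `U(N)` link field in a constant central phase.  The factor
`N` is genuine (Cauchy–Schwarz over the colour entries of a row, `sq_sum_block_le`); `256 · 3 = 768`
is the sibling's constant. -/
theorem sum_sq_rowsum_delta_le {θ : ℝ} {ω : Matrix.unitaryGroup (Fin N) ℂ}
    (hω : (ω : Matrix (Fin N) (Fin N) ℂ) = Complex.exp (θ * I) • (1 : Matrix (Fin N) (Fin N) ℂ))
    (V : GaugeConfig 4 L (Matrix.unitaryGroup (Fin N) ℂ)) (m : ℝ) :
    ∑ p : TorusSite 4 L × Fin N × Fin 4, (∑ q : TorusSite 4 L × Fin N × Fin 4,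
      ‖(wilsonDirac (unitaryFundamentalRep (Fin N) ℂ) (fun e => ω * V e) m 1 -
          wilsonDirac (unitaryFundamentalRep (Fin N) ℂ)
            (fun _ : Edge 4 L => ω) m 1) p q‖) ^ 2 ≤
      256 * N * ∑ e : Edge 4 L, ((N : ℝ) - ((V e : Matrix (Fin N) (Fin N) ℂ)).trace.re) := by
  -- adapted from the sibling `sum_sq_rowsum_delta_le` (`12 ↦ 4N`, `24 ↦ 8N`, `768 ↦ 256N`)
  -- notation
  set Gm : Fin 4 → Matrix (Fin 4) (Fin 4) ℂ := fun μ => (1 : Matrix (Fin 4) (Fin 4) ℂ) - euclideanGamma μ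
    with hGm
  set Gp : Fin 4 → Matrix (Fin 4) (Fin 4) ℂ := fun μ => (1 : Matrix (Fin 4) (Fin 4) ℂ) + euclideanGamma μ
    with hGp
  set Cf : Fin 4 → TorusSite 4 L → Matrix (Fin N) (Fin N) ℂ := fun μ x =>
    unitaryFundamentalRep (Fin N) ℂ (ω * V (x, μ)) - unitaryFundamentalRep (Fin N) ℂ ω with hCf
  set Cb : Fin 4 → TorusSite 4 L → Matrix (Fin N) (Fin N) ℂ := fun μ y =>
    unitaryFundamentalRep (Fin N) ℂ (ω * V (y, μ))⁻¹ - unitaryFundamentalRep (Fin N) ℂ ω⁻¹ with hCb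
  set d : Fin 4 → TorusSite 4 L → ℝ := fun μ x =>
    (N : ℝ) - ((V (x, μ) : Matrix (Fin N) (Fin N) ℂ)).trace.re with hd
  -- Frobenius sums of the blocks
  have hG8m : ∀ μ, ∑ α, ∑ β, ‖Gm μ α β‖ ^ 2 = 8 := fun μ => by
    have := sum_norm_sq_one_add_smul_gamma μ (-1) (Or.inr rfl)
    simpa [hGm, sub_eq_add_neg] using this
  have hG8p : ∀ μ, ∑ α, ∑ β, ‖Gp μ α β‖ ^ 2 = 8 := fun μ => by
    have := sum_norm_sq_one_add_smul_gamma μ 1 (Or.inl rfl)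
    simpa [hGp] using this
  have hCf2 : ∀ μ x, ∑ a, ∑ b, ‖Cf μ x a b‖ ^ 2 = 2 * d μ x := fun μ x => by
    simp only [hCf, hd, rep_phase_mul_sub hω, norm_exp_mul_I_smul_apply]
    exact sum_norm_sq_sub_one (V (x, μ))
  have hCb2 : ∀ μ y, ∑ a, ∑ b, ‖Cb μ y a b‖ ^ 2 = 2 * d μ y := fun μ y => by
    simp only [hCb, hd, rep_phase_mul_inv_sub hω, norm_exp_neg_mul_I_smul_star_sub_one_apply]
    rw [Finset.sum_comm]
    exact sum_norm_sq_sub_one (V (y, μ))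
  -- Step 1: row sums
  have hrow : ∀ p : TorusSite 4 L × Fin N × Fin 4,
      ∑ q, ‖(wilsonDirac (unitaryFundamentalRep (Fin N) ℂ) (fun e => ω * V e) m 1 -
          wilsonDirac (unitaryFundamentalRep (Fin N) ℂ) (fun _ : Edge 4 L => ω) m 1) p q‖ ≤
        (1 / 2) * ∑ μ, ((∑ s : Fin N × Fin 4, ‖Gm μ p.2.2 s.2‖ * ‖Cf μ p.1 p.2.1 s.1‖) +
          ∑ s : Fin N × Fin 4, ‖Gp μ p.2.2 s.2‖ * ‖Cb μ (p.1 - Pi.single μ 1) p.2.1 s.1‖) := by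
    intro p
    have hpt : ∀ q, ‖(wilsonDirac (unitaryFundamentalRep (Fin N) ℂ) (fun e => ω * V e) m 1 -
          wilsonDirac (unitaryFundamentalRep (Fin N) ℂ) (fun _ : Edge 4 L => ω) m 1) p q‖ ≤
        (1 / 2) * ∑ μ, (‖(if q.1 = Site.shift p.1 μ then Gm μ p.2.2 q.2.2 * Cf μ p.1 p.2.1 q.2.1 else 0)‖ +
          ‖(if p.1 = Site.shift q.1 μ then Gp μ p.2.2 q.2.2 * Cb μ q.1 p.2.1 q.2.1 else 0)‖) := by
      intro q
      rw [wilsonDirac_phase_sub_apply]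
      simp only [one_smul]
      rw [norm_mul, norm_neg]
      refine mul_le_mul (by norm_num) ((norm_sum_le _ _).trans (Finset.sum_le_sum fun μ _ =>
        norm_add_le _ _)) (norm_nonneg _) (by norm_num)
    refine (Finset.sum_le_sum fun q _ => hpt q).trans ?_
    rw [← Finset.mul_sum, Finset.sum_comm]
    refine mul_le_mul_of_nonneg_left (le_of_eq ?_) (by norm_num)
    refine Finset.sum_congr rfl fun μ _ => ?_
    rw [Finset.sum_add_distrib]
    congr 1
    · rw [sum_norm_ite_site_eq (Site.shift p.1 μ) (fun s : Fin N × Fin 4 => Gm μ p.2.2 s.2 * Cf μ p.1 p.2.1 s.1)]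
      simp_rw [norm_mul]
    · rw [sum_norm_ite_shift_eq p.1 μ (fun y (s : Fin N × Fin 4) => Gp μ p.2.2 s.2 * Cb μ y p.2.1 s.1)]
      simp_rw [norm_mul]
  -- Step 2: square and Cauchy–Schwarz
  have hsq : ∀ p : TorusSite 4 L × Fin N × Fin 4,
      (∑ q, ‖(wilsonDirac (unitaryFundamentalRep (Fin N) ℂ) (fun e => ω * V e) m 1 -
          wilsonDirac (unitaryFundamentalRep (Fin N) ℂ) (fun _ : Edge 4 L => ω) m 1) p q‖) ^ 2 ≤
        ∑ μ, (8 * N * ((∑ β, ‖Gm μ p.2.2 β‖ ^ 2) * ∑ b, ‖Cf μ p.1 p.2.1 b‖ ^ 2) +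
          8 * N * ((∑ β, ‖Gp μ p.2.2 β‖ ^ 2) * ∑ b, ‖Cb μ (p.1 - Pi.single μ 1) p.2.1 b‖ ^ 2)) := by
    intro p
    have h0 := hrow p
    have hnn : 0 ≤ ∑ q, ‖(wilsonDirac (unitaryFundamentalRep (Fin N) ℂ) (fun e => ω * V e) m 1 -
          wilsonDirac (unitaryFundamentalRep (Fin N) ℂ) (fun _ : Edge 4 L => ω) m 1) p q‖ :=
      Finset.sum_nonneg fun _ _ => norm_nonneg _
    have hN0 : (0 : ℝ) ≤ N := Nat.cast_nonneg N
    set A : Fin 4 → ℝ := fun μ => ∑ s : Fin N × Fin 4, ‖Gm μ p.2.2 s.2‖ * ‖Cf μ p.1 p.2.1 s.1‖ with hA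
    set B : Fin 4 → ℝ := fun μ => ∑ s : Fin N × Fin 4,
      ‖Gp μ p.2.2 s.2‖ * ‖Cb μ (p.1 - Pi.single μ 1) p.2.1 s.1‖ with hB
    have hA2 : ∀ μ, A μ ^ 2 ≤ 4 * N * (∑ β, ‖Gm μ p.2.2 β‖ ^ 2) * ∑ b, ‖Cf μ p.1 p.2.1 b‖ ^ 2 :=
      fun μ => sq_sum_block_le _ _ _ _
    have hB2 : ∀ μ, B μ ^ 2 ≤
        4 * N * (∑ β, ‖Gp μ p.2.2 β‖ ^ 2) * ∑ b, ‖Cb μ (p.1 - Pi.single μ 1) p.2.1 b‖ ^ 2 :=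
      fun μ => sq_sum_block_le _ _ _ _
    calc (∑ q, ‖(wilsonDirac (unitaryFundamentalRep (Fin N) ℂ) (fun e => ω * V e) m 1 -
          wilsonDirac (unitaryFundamentalRep (Fin N) ℂ) (fun _ : Edge 4 L => ω) m 1) p q‖) ^ 2
        ≤ ((1 / 2) * ∑ μ, (A μ + B μ)) ^ 2 := pow_le_pow_left₀ hnn h0 2
      _ = (1 / 4) * (∑ μ, (A μ + B μ)) ^ 2 := by ring
      _ ≤ (1 / 4) * (4 * ∑ μ, (A μ + B μ) ^ 2) := by
          gcongr
          simpa using sq_sum_le_card_mul_sum_sq (s := Finset.univ) (f := fun μ => A μ + B μ)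
      _ = ∑ μ, (A μ + B μ) ^ 2 := by ring
      _ ≤ ∑ μ, (2 * A μ ^ 2 + 2 * B μ ^ 2) :=
          Finset.sum_le_sum fun μ _ => by nlinarith [sq_nonneg (A μ - B μ)]
      _ ≤ _ := Finset.sum_le_sum fun μ _ => by nlinarith [hA2 μ, hB2 μ]
  -- Step 3: sum over rows
  refine (Finset.sum_le_sum fun p _ => hsq p).trans ?_
  rw [Finset.sum_comm]
  -- per direction
  have hdir : ∀ μ, ∑ p : TorusSite 4 L × Fin N × Fin 4,
      (8 * N * ((∑ β, ‖Gm μ p.2.2 β‖ ^ 2) * ∑ b, ‖Cf μ p.1 p.2.1 b‖ ^ 2) +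
        8 * N * ((∑ β, ‖Gp μ p.2.2 β‖ ^ 2) * ∑ b, ‖Cb μ (p.1 - Pi.single μ 1) p.2.1 b‖ ^ 2)) =
      256 * N * ∑ x, d μ x := by
    intro μ
    rw [Finset.sum_add_distrib, ← Finset.mul_sum, ← Finset.mul_sum]
    have h1 : ∑ p : TorusSite 4 L × Fin N × Fin 4,
        (∑ β, ‖Gm μ p.2.2 β‖ ^ 2) * ∑ b, ‖Cf μ p.1 p.2.1 b‖ ^ 2 = 8 * ∑ x, 2 * d μ x := by
      rw [Fintype.sum_prod_type]
      have hx : ∀ x : TorusSite 4 L, ∑ s : Fin N × Fin 4,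
          (∑ β, ‖Gm μ s.2 β‖ ^ 2) * ∑ b, ‖Cf μ x s.1 b‖ ^ 2 = 8 * (2 * d μ x) := fun x => by
        rw [Fintype.sum_prod_type, ← hG8m μ, ← hCf2 μ x, Finset.sum_mul_sum, Finset.sum_comm]
      simp_rw [hx]
      rw [Finset.mul_sum]
    have h2 : ∑ p : TorusSite 4 L × Fin N × Fin 4,
        (∑ β, ‖Gp μ p.2.2 β‖ ^ 2) * ∑ b, ‖Cb μ (p.1 - Pi.single μ 1) p.2.1 b‖ ^ 2 =
          8 * ∑ x, 2 * d μ x := by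
      rw [Fintype.sum_prod_type]
      have hx : ∀ x : TorusSite 4 L, ∑ s : Fin N × Fin 4,
          (∑ β, ‖Gp μ s.2 β‖ ^ 2) * ∑ b, ‖Cb μ (x - Pi.single μ 1) s.1 b‖ ^ 2 =
            8 * (2 * d μ (x - Pi.single μ 1)) := fun x => by
        rw [Fintype.sum_prod_type, ← hG8p μ, ← hCb2 μ (x - Pi.single μ 1), Finset.sum_mul_sum,
          Finset.sum_comm]
      simp_rw [hx]
      rw [← Finset.mul_sum]
      congr 1
      exact Equiv.sum_comp (Equiv.subRight (Pi.single μ (1 : ZMod L))) (fun x => 2 * d μ x)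
    rw [h1, h2, ← Finset.mul_sum]
    ring
  simp_rw [hdir]
  rw [← Finset.mul_sum]
  refine le_of_eq ?_
  congr 1
  rw [Fintype.sum_prod_type, Finset.sum_comm]

/-- **Registered sub-goal of this file** (`stub_tangentDeltaAllN`): the conjunction, at colour
`Fin N`, of the exports of the sibling toolbox `…WilsonQuarkStabilityTangentDelta` consumed by the
Frobenius/operator bounds of the hopping perturbation (siblings `…StubDeltaBounds`,
`…StubUnitaryCellIneq`): `Σ_{ab} ‖M_{ab}‖² = Re tr(Mᴴ M)`; `Σ_{ab} ‖(g − 1)_{ab}‖² = 2 (N − Re tr g)`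
for `g ∈ U(N)`; `‖1 + σγ_μ‖_F² = 8` for `σ = ±1`; and `x = y + μ̂ ↔ y = x − μ̂` on `(ℤ/L)⁴`. -/
theorem stub_tangentDeltaAllN : ∀ (N : ℕ), (∀ M : Matrix (Fin N) (Fin N) ℂ, ∑ a, ∑ b, ‖M a b‖ ^ 2 = (Mᴴ * M).trace.re) ∧ (∀ g : Matrix.unitaryGroup (Fin N) ℂ, ∑ a, ∑ b, ‖(((g : Matrix.unitaryGroup (Fin N) ℂ) : Matrix (Fin N) (Fin N) ℂ) - 1) a b‖ ^ 2 = 2 * ((N : ℝ) - ((g : Matrix.unitaryGroup (Fin N) ℂ) : Matrix (Fin N) (Fin N) ℂ).trace.re)) ∧ (∀ (μ : Fin 4) (σ : ℝ), σ = 1 ∨ σ = -1 → ∑ α, ∑ β, ‖((1 : Matrix (Fin 4) (Fin 4) ℂ) + (σ : ℂ) • euclideanGamma μ) α β‖ ^ 2 = 8) ∧ (∀ (L : ℕ) (x y : TorusSite 4 L) (μ : Fin 4), x = Site.shift y μ ↔ y = x - Pi.single μ 1) :=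
  fun _ => ⟨fun M => sum_norm_sq_eq_re_trace_conjTranspose_mul_self M, fun g => sum_norm_sq_sub_one g,
    fun μ σ hσ => sum_norm_sq_one_add_smul_gamma μ σ hσ, fun _ x y μ => eq_shift_iff' x y μ⟩

end

end Summit.QuantumFields.QCD.Cruxes.FlatCellOptimal.TangentDelta
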